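import Literature.NumberTheory.EllipticCurves.SelmerTorsionRestriction
import Literature.NumberTheory.EllipticCurves.ArchimedeanLocalConditionTorsion
import HarnessLib

/-!
# Route `CMKolyvaginAtInertTwo`, crux `CMKolyvaginExactAtInertTwo` (stmt-BirchSwinnertonDyer-24277):
# plumbing for the over-`ℚ` bit — the Selmer local condition is FUNCTORIAL under restriction
# `H¹(ℚ, E[n]) → H¹(K, E[n])` at finite places `w ∣ v`

Seat `bsd-line-cmk2-p1` g8 (cell `bsd-print-cf2`); helper (`--supports stmt-BirchSwinnertonDyer-24277`);
eighth file of the over-`ℚ` bit. THEOREMS ONLY; no item is closed; BSD is not proved by this.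

The discharge of the binder (dual) of `…RationalDescentAtTwoPrimeDiscr` from the second-bit theorem
`…RationalDescentAtTwoReciprocity.torsionLocalKer_of_reciprocity_rat` (p631788) needs two pieces of
local plumbing between the places of `ℚ` and of `K`: (tower) for the STRICT kernels `torsionLocalKer`
(not here) and the forward functoriality of the SELMER kernels — here, for any number field `K`, any
`W/ℚ`, any `n` and any finite place `w` of `K` over `v = w ∩ ℚ`:
`ξ ∈ selmerLocalKer W ℚ_v n ⟹ res ξ ∈ selmerLocalKer (W⁄K) K_w n` (`resTorsion_mem_selmerLocalKer_of_under`).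
It is the level-`n` pull-back (tree `mem_selmerLocalKer_iff_torsionH1ToH1_mem`, `torsionH1ToH1_resTorsion`)
of the tree's `H¹(K, E)`-level tower lemmas `ShaRestriction.localRestrictionKer_le_of_tower` and
`mem_localRestrictionKer_iff_resBaseChange_mem` (with the completion tower `ℚ → ℚ_v → K_w` set up as in
`resBaseChange_mem_sha`). Use: a descended Kolyvagin class `κ` (`res κ = c(ℓ)`) which is NOT Selmer at
`λ` over `K` is not Selmer at `ℓ` over `ℚ` (`not_mem_selmerLocalKer_of_resTorsion_not_mem`).

References: [SerreGaloisCohomology1997] I §2.4, II §1.1; [MilneADT2006] I §6; H. Darmon, *Rational points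
on modular elliptic curves* (2004), §3.9.
-/

-- single-conjunct summit: `Summit.BirchSwinnertonDyer.BirchSwinnertonDyer.…` repeats the name by design
set_option linter.dupNamespace false
set_option autoImplicit false

noncomputable section

open scoped Classical
open WeierstrassCurve NumberField IsDedekindDomain Field
open Literature.NumberTheory.GaloisRepresentations Literature.NumberTheory.EllipticCurves

namespace Summit.BirchSwinnertonDyer.BirchSwinnertonDyer.Theorems.KolyvaginRatDescentTwo

variable (K : Type) [Field K] [NumberField K] (W : WeierstrassCurve ℚ) (n : ℤ)

/-- **The Selmer local condition is functorial under restriction**: for a finite place `w` of `K` over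
the place `v = w.under (𝓞 ℚ)` of `ℚ` and `ξ ∈ H¹(ℚ, E[n])` satisfying the Selmer local condition at
`ℚ_v`, the restriction `res ξ ∈ H¹(K, E_K[n])` satisfies it at `K_w` (the class dies in `H¹(ℚ_v, E)`,
hence in `H¹(K_w, E)` along `ℚ_v → K_w`, and that is the local condition of `res ξ` at `w`).
[cite: SerreGaloisCohomology1997, I.§2.4 (compatible pairs) and II.§1.1] [cite: MilneADT2006, I.§6] -/
theorem resTorsion_mem_selmerLocalKer_of_under (w : HeightOneSpectrum (𝓞 K)) {ξ : galH1Torsion W n}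
    (hξ : ξ ∈ selmerLocalKer W ((w.under (𝓞 ℚ)).adicCompletion ℚ) n) :
    resTorsion W K n ξ ∈ selmerLocalKer (W.baseChange K) (w.adicCompletion K) n := by
  let v : HeightOneSpectrum (𝓞 ℚ) := w.under (𝓞 ℚ)
  haveI : w.asIdeal.LiesOver v.asIdeal := ⟨rfl⟩
  letI : Algebra (v.adicCompletion ℚ) (w.adicCompletion K) :=
    (adicCompletionMap (K := ℚ) K v w).toAlgebra
  haveI : IsScalarTower ℚ (v.adicCompletion ℚ) (w.adicCompletion K) :=
    IsScalarTower.of_algebraMap_eq fun x ↦ (adicCompletionMap_coe (K := ℚ) K v w x).symm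
  rw [WeierstrassCurve.mem_selmerLocalKer_iff_torsionH1ToH1_mem] at hξ ⊢
  rw [torsionH1ToH1_resTorsion]
  exact (mem_localRestrictionKer_iff_resBaseChange_mem W _).mp
    (localRestrictionKer_le_of_tower W (E := v.adicCompletion ℚ) hξ)

/-- **Contrapositive, the form the (dual) discharge uses**: if `res ξ` is NOT Selmer at a finite place
`w` of `K`, then `ξ` is not Selmer at the place `w.under (𝓞 ℚ)` of `ℚ` (for the descended Kolyvagin
class: `c(ℓ)` not Selmer at `λ` ⟹ `κ_ℓ` not Selmer at `ℓ`). [cite: MilneADT2006, I.§6] -/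
theorem not_mem_selmerLocalKer_of_resTorsion_not_mem (w : HeightOneSpectrum (𝓞 K)) {ξ : galH1Torsion W n}
    (h : resTorsion W K n ξ ∉ selmerLocalKer (W.baseChange K) (w.adicCompletion K) n) :
    ξ ∉ selmerLocalKer W ((w.under (𝓞 ℚ)).adicCompletion ℚ) n :=
  fun hξ ↦ h (resTorsion_mem_selmerLocalKer_of_under K W n w hξ)

end Summit.BirchSwinnertonDyer.BirchSwinnertonDyer.Theorems.KolyvaginRatDescentTwo

end
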